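import Mathlib.Algebra.CubicDiscriminant
import Mathlib.LinearAlgebra.Matrix.Determinant.Basic
import Mathlib.LinearAlgebra.Matrix.NonsingularInverse
import Mathlib.Data.Int.Basic
import HarnessLib

/-!
# Integral binary cubic forms: the lattice `V(ℤ)`, the discriminant, and the (twisted) action of `GL₂`

Topic `Literature/NumberTheory/CubicFields`. The first piece of vocabulary of the
Davenport–Heilbronn / Delone–Faddeev approach to counting cubic fields and the 3-torsion of class
groups of quadratic fields (Bhargava–Taniguchi–Thorne 2023, §2.2, displays (6)–(8); the same
set-up in Davenport–Heilbronn 1971, Bhargava–Shankar–Tsimerman 2013 §2, Taniguchi–Thorne 2013):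

* "The lattice of integral binary cubic forms is defined by
  `V(ℤ) := {a u³ + b u²v + c uv² + d v³ : a, b, c, d ∈ ℤ}`" (BTT (6)) — here the structure
  `BinaryCubic R` (four coefficients over any commutative ring `R`; `V(R)`), with evaluation
  `eval`, change of ring `map`, scaling `μ • f`, and the bridge `toCubic` to Mathlib's univariate
  `Cubic R` (`f(u, 1)`);
* "the discriminant … `Disc(f) = b²c² − 4ac³ − 4b³d − 27a²d² + 18abcd`" (BTT (7)) — `disc`,
  DEFINED as Mathlib's `Cubic.discr` of `toCubic` (same polynomial, `disc_eq`);
* "The group `GL₂(ℤ)` acts on `V(ℤ)` by `(γ · f)(u, v) = (1/det γ) · f((u, v) · γ)`" (BTT (8)) — the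
  substitution action `subst` of all `2 × 2` matrices (`(f.subst γ)(u,v) = f((u,v)γ)`,
  `eval_subst`; a left action, `subst_one`, `subst_mul`), its effect on the discriminant
  `disc (f.subst γ) = (det γ)⁶ disc f` (`disc_subst`), and the TWISTED action
  `twist γ f = (det γ) • f.subst γ` — which IS BTT's `(1/det γ) f((u,v)γ)` for `γ ∈ GL₂(ℤ)` since
  `det γ = ±1 = (det γ)⁻¹` — with `disc (twist γ f) = (det γ)¹⁰ disc f`, hence
  **`Disc(γ · f) = Disc(f)` for `γ ∈ GL₂(ℤ)`** (`disc_twist_of_isUnit`), and the resulting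
  `GL₂(ℤ)`-equivalence of integral forms (`GL2ZEquiv`, an equivalence relation preserving `disc`:
  `GL2ZEquiv.refl/symm/trans/disc_eq`, `gl2zOrbit`).

Everything here is a definition with body or a proved identity; nothing is a named fact. NOT here
(the next pieces of BTT §2): the Levi–Delone–Faddeev bijection between `GL₂(ℤ)`-orbits on `V(ℤ)`
and cubic rings (BTT Thm 2.1), the Davenport–Heilbronn maximality sets `U_p` (BTT Prop. 2.2),
reducibility/irreducibility of forms versus orders in cubic fields, and Shintani's zeta functions
(BTT §2.4).

## References

* M. Bhargava, T. Taniguchi, F. Thorne, *Improved error estimates for the Davenport–Heilbronn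
  theorems*, Math. Ann. 389 (2024) = arXiv:2107.12819, §2.2 (6)–(8) [BhargavaTaniguchiThorne2023].
* H. Davenport, H. Heilbronn, *On the density of discriminants of cubic fields. II*, Proc. Roy.
  Soc. London A 322 (1971) 405–420 [DavenportHeilbronn1971].
* M. Bhargava, A. Shankar, J. Tsimerman, *On the Davenport–Heilbronn theorems and second order
  terms*, Invent. Math. 193 (2013), §2 [BhargavaShankarTsimerman2012].
* W. T. Gan, B. Gross, G. Savin, *Fourier coefficients of modular forms on `G₂`*, Duke Math. J.
  115 (2002), §4 (binary cubic forms and cubic rings, degenerate case) [GanGrossSavin2002].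

## Design (searched: Mathlib has `Cubic R` = univariate cubics with `Cubic.discr`, no binary forms,
no `GL₂`-action on them; the tree has the parallel `Literature.NumberTheory.EllipticCurves.BinaryQuartic`)

* A four-field `structure`, as for the tree's `BinaryQuartic` and Mathlib's `Cubic`, rather than
  `MvPolynomial`/homogeneous polynomials: the action and the discriminant are explicit polynomial
  maps in the coefficients, and all identities below are closed by `ring`.
* `disc` is Mathlib's `Cubic.discr (toCubic f)`, so Mathlib's API for cubics (roots,
  `Cubic.discr_ne_zero_iff_roots_nodup` over fields) applies to `f(u, 1)`.
* The twisted action is defined for every integral matrix by `(det γ) • f.subst γ` (total, no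
  division); on `GL₂(ℤ)` it is the printed `(det γ)⁻¹ f((u,v)γ)`. No `MulAction` instance is
  registered (the acting monoid would be `Matrix (Fin 2) (Fin 2) ℤ` with the twisted law, which is
  only an action up to the sign convention); orbits are handled through the relation `GL2ZEquiv`.
-/

namespace Literature.NumberTheory.CubicFields

/-- A binary cubic form `f(u,v) = a u³ + b u²v + c uv² + d v³` with coefficients in `R` — an element
of `V(R)`; for `R = ℤ` the lattice `V(ℤ)` of integral binary cubic forms
(Bhargava–Taniguchi–Thorne 2023, §2.2 (6)). [cite: BhargavaTaniguchiThorne2023, §2.2 (6)] -/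
@[ext]
structure BinaryCubic (R : Type*) where
  /-- coefficient of `u³` -/
  a : R
  /-- coefficient of `u²v` -/
  b : R
  /-- coefficient of `uv²` -/
  c : R
  /-- coefficient of `v³` -/
  d : R

namespace BinaryCubic

section Basic

variable {R : Type*}

/-- The dehomogenisation `f(u, 1) = a u³ + b u² + c u + d` as a Mathlib `Cubic`. [folklore] -/
def toCubic (f : BinaryCubic R) : Cubic R :=
  ⟨f.a, f.b, f.c, f.d⟩

/-- `toCubic` on coefficients (definitional). [folklore] -/
@[simp] theorem toCubic_a (f : BinaryCubic R) : f.toCubic.a = f.a := rfl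
/-- `toCubic` on coefficients (definitional). [folklore] -/
@[simp] theorem toCubic_b (f : BinaryCubic R) : f.toCubic.b = f.b := rfl
/-- `toCubic` on coefficients (definitional). [folklore] -/
@[simp] theorem toCubic_c (f : BinaryCubic R) : f.toCubic.c = f.c := rfl
/-- `toCubic` on coefficients (definitional). [folklore] -/
@[simp] theorem toCubic_d (f : BinaryCubic R) : f.toCubic.d = f.d := rfl

/-- `toCubic` is injective (a binary cubic form is its coefficient vector). [folklore] -/
theorem toCubic_injective : Function.Injective (toCubic : BinaryCubic R → Cubic R) := by
  intro f g h
  have ha := congrArg Cubic.a h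
  have hb := congrArg Cubic.b h
  have hc := congrArg Cubic.c h
  have hd := congrArg Cubic.d h
  simp only [toCubic_a, toCubic_b, toCubic_c, toCubic_d] at ha hb hc hd
  exact BinaryCubic.ext ha hb hc hd

end Basic

section CommRing

variable {R S : Type*} [CommRing R] [CommRing S]

/-- The value `f(u,v) = a u³ + b u²v + c uv² + d v³` (BTT 2023, §2.2 (6)). [folklore] -/
def eval (f : BinaryCubic R) (u v : R) : R :=
  f.a * u ^ 3 + f.b * u ^ 2 * v + f.c * u * v ^ 2 + f.d * v ^ 3

/-- `f(u, 1)` is the value of the cubic polynomial `toCubic f` at `u`. [folklore] -/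
theorem eval_one_right (f : BinaryCubic R) (u : R) : f.eval u 1 = f.toCubic.toPoly.eval u := by
  simp only [eval, toCubic, Cubic.toPoly, Polynomial.eval_add, Polynomial.eval_mul, Polynomial.eval_C,
    Polynomial.eval_pow, Polynomial.eval_X]
  ring

/-- Change of coefficient ring along a ring homomorphism (`ℤ → ℝ`, `ℤ → ℤ/mℤ`, `ℤ → ℤ_p`: the maps
behind `V(ℝ)`, `V(ℤ/mℤ)` in BTT §2.3–2.4). [folklore] -/
def map (φ : R →+* S) (f : BinaryCubic R) : BinaryCubic S :=
  ⟨φ f.a, φ f.b, φ f.c, φ f.d⟩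

/-- `map` on the coefficient `a` (definitional). [folklore] -/
@[simp] theorem map_a (φ : R →+* S) (f : BinaryCubic R) : (f.map φ).a = φ f.a := rfl
/-- `map` on the coefficient `b` (definitional). [folklore] -/
@[simp] theorem map_b (φ : R →+* S) (f : BinaryCubic R) : (f.map φ).b = φ f.b := rfl
/-- `map` on the coefficient `c` (definitional). [folklore] -/
@[simp] theorem map_c (φ : R →+* S) (f : BinaryCubic R) : (f.map φ).c = φ f.c := rfl
/-- `map` on the coefficient `d` (definitional). [folklore] -/
@[simp] theorem map_d (φ : R →+* S) (f : BinaryCubic R) : (f.map φ).d = φ f.d := rfl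

/-- `map` commutes with evaluation. [folklore] -/
theorem eval_map (φ : R →+* S) (f : BinaryCubic R) (u v : R) :
    (f.map φ).eval (φ u) (φ v) = φ (f.eval u v) := by
  simp [eval, map]

/-- `map` commutes with `toCubic` (Mathlib's `Cubic.map`). [folklore] -/
theorem toCubic_map (φ : R →+* S) (f : BinaryCubic R) : (f.map φ).toCubic = f.toCubic.map φ := rfl

/-- Scaling all coefficients: `(μ • f)(u,v) = μ f(u,v)`. [folklore] -/
instance : SMul R (BinaryCubic R) :=
  ⟨fun μ f => ⟨μ * f.a, μ * f.b, μ * f.c, μ * f.d⟩⟩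

/-- Scaling on the coefficient `a` (definitional). [folklore] -/
@[simp] theorem smul_a (μ : R) (f : BinaryCubic R) : (μ • f).a = μ * f.a := rfl
/-- Scaling on the coefficient `b` (definitional). [folklore] -/
@[simp] theorem smul_b (μ : R) (f : BinaryCubic R) : (μ • f).b = μ * f.b := rfl
/-- Scaling on the coefficient `c` (definitional). [folklore] -/
@[simp] theorem smul_c (μ : R) (f : BinaryCubic R) : (μ • f).c = μ * f.c := rfl
/-- Scaling on the coefficient `d` (definitional). [folklore] -/
@[simp] theorem smul_d (μ : R) (f : BinaryCubic R) : (μ • f).d = μ * f.d := rfl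

/-- `(μ • f)(u,v) = μ · f(u,v)`. [folklore] -/
theorem eval_smul (μ : R) (f : BinaryCubic R) (u v : R) : (μ • f).eval u v = μ * f.eval u v := by
  simp only [eval, smul_a, smul_b, smul_c, smul_d]
  ring

/-- Scaling is a monoid action of `R`. [folklore] -/
instance : MulAction R (BinaryCubic R) where
  one_smul f := by ext <;> simp
  mul_smul μ ν f := by ext <;> simp [mul_assoc]

/-! ### The discriminant -/

/-- The discriminant `Disc(f) = b²c² − 4ac³ − 4b³d − 27a²d² + 18abcd` of a binary cubic form
(Bhargava–Taniguchi–Thorne 2023, §2.2 (7)), defined as Mathlib's `Cubic.discr` of `f(u,1)` — the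
same polynomial (`disc_eq`). [cite: BhargavaTaniguchiThorne2023, §2.2 (7)] -/
def disc (f : BinaryCubic R) : R :=
  f.toCubic.discr

/-- BTT (7): `Disc(f) = b²c² − 4ac³ − 4b³d − 27a²d² + 18abcd`. [cite: BhargavaTaniguchiThorne2023, §2.2 (7)] -/
theorem disc_eq (f : BinaryCubic R) :
    f.disc = f.b ^ 2 * f.c ^ 2 - 4 * f.a * f.c ^ 3 - 4 * f.b ^ 3 * f.d - 27 * f.a ^ 2 * f.d ^ 2
      + 18 * f.a * f.b * f.c * f.d := rfl

/-- `Disc` commutes with change of ring. [folklore] -/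
@[simp] theorem disc_map (φ : R →+* S) (f : BinaryCubic R) : (f.map φ).disc = φ f.disc := by
  simp only [disc_eq, map_a, map_b, map_c, map_d, map_add, map_sub, map_mul, map_pow, map_ofNat]

/-- `Disc(μ f) = μ⁴ Disc(f)` (the discriminant is a quartic form in the coefficients). [folklore] -/
theorem disc_smul (μ : R) (f : BinaryCubic R) : (μ • f).disc = μ ^ 4 * f.disc := by
  simp only [disc_eq, smul_a, smul_b, smul_c, smul_d]
  ring

/-- Examples: `Disc(uv(u+v)) = 1` (`a = 0, b = 1, c = 1, d = 0`) and `Disc(u³ + v³) = −27`.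
[folklore] -/
example : (⟨0, 1, 1, 0⟩ : BinaryCubic ℤ).disc = 1 ∧ (⟨1, 0, 0, 1⟩ : BinaryCubic ℤ).disc = -27 := by
  constructor <;> simp [disc_eq]

/-! ### The substitution action of `2 × 2` matrices and the twisted `GL₂`-action -/

/-- The substitution action of a `2 × 2` matrix `γ = (p q; r s)`:
`(f.subst γ)(u,v) = f((u,v)γ) = f(pu + rv, qu + sv)` (`eval_subst`), written out on coefficients
(BTT 2023, §2.2 (8), before the twist by `1/det γ`; a left action, `subst_mul`).
[cite: BhargavaTaniguchiThorne2023, §2.2 (8)] -/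
def subst (f : BinaryCubic R) (γ : Matrix (Fin 2) (Fin 2) R) : BinaryCubic R :=
  let p := γ 0 0; let q := γ 0 1; let r := γ 1 0; let s := γ 1 1
  ⟨f.a * p ^ 3 + f.b * p ^ 2 * q + f.c * p * q ^ 2 + f.d * q ^ 3,
    3 * f.a * p ^ 2 * r + f.b * (p ^ 2 * s + 2 * p * q * r) + f.c * (2 * p * q * s + q ^ 2 * r)
      + 3 * f.d * q ^ 2 * s,
    3 * f.a * p * r ^ 2 + f.b * (2 * p * r * s + q * r ^ 2) + f.c * (p * s ^ 2 + 2 * q * r * s)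
      + 3 * f.d * q * s ^ 2,
    f.a * r ^ 3 + f.b * r ^ 2 * s + f.c * r * s ^ 2 + f.d * s ^ 3⟩

/-- `(f.subst γ)(u,v) = f((u,v)γ)` with `(u,v)γ = (u γ₀₀ + v γ₁₀, u γ₀₁ + v γ₁₁)` (BTT 2023,
§2.2 (8)). [cite: BhargavaTaniguchiThorne2023, §2.2 (8)] -/
theorem eval_subst (f : BinaryCubic R) (γ : Matrix (Fin 2) (Fin 2) R) (u v : R) :
    (f.subst γ).eval u v = f.eval (u * γ 0 0 + v * γ 1 0) (u * γ 0 1 + v * γ 1 1) := by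
  simp only [subst, eval]
  ring

/-- The identity matrix acts trivially. [folklore] -/
@[simp] theorem subst_one (f : BinaryCubic R) : f.subst 1 = f := by
  ext <;> simp [subst]

/-- The substitution action is a left action: `f.subst (γ₁ γ₂) = (f.subst γ₂).subst γ₁`, i.e.
`(γ₁γ₂) · f = γ₁ · (γ₂ · f)` for `γ · f := f ∘ (· γ)`. [folklore] -/
theorem subst_mul (f : BinaryCubic R) (γ₁ γ₂ : Matrix (Fin 2) (Fin 2) R) :
    f.subst (γ₁ * γ₂) = (f.subst γ₂).subst γ₁ := by
  ext <;> simp only [subst, Matrix.mul_apply, Fin.sum_univ_two] <;> ring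

/-- Scaling commutes with substitution. [folklore] -/
theorem smul_subst (μ : R) (f : BinaryCubic R) (γ : Matrix (Fin 2) (Fin 2) R) :
    (μ • f).subst γ = μ • f.subst γ := by
  ext <;> simp only [subst, smul_a, smul_b, smul_c, smul_d] <;> ring

/-- `map` commutes with substitution. [folklore] -/
theorem map_subst (φ : R →+* S) (f : BinaryCubic R) (γ : Matrix (Fin 2) (Fin 2) R) :
    (f.subst γ).map φ = (f.map φ).subst (γ.map φ) := by
  ext <;> simp only [subst, map, Matrix.map_apply, map_add, map_mul, map_pow, map_ofNat]

/-- **The discriminant is a relative invariant of weight `6`**: `Disc(f ∘ γ) = (det γ)⁶ Disc(f)`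
for every `2 × 2` matrix `γ` (so `Disc` is `SL₂`-invariant and `GL₂(ℤ)`-invariant). [folklore] -/
theorem disc_subst (f : BinaryCubic R) (γ : Matrix (Fin 2) (Fin 2) R) :
    (f.subst γ).disc = γ.det ^ 6 * f.disc := by
  simp only [subst, disc_eq, Matrix.det_fin_two]
  ring

/-- The TWISTED action `γ · f := (det γ) • (f ∘ γ)` of an integral-type matrix; for `γ ∈ GL₂(ℤ)`
(`det γ = ±1 = (det γ)⁻¹`) this is exactly BTT's `(γ · f)(u,v) = (1/det γ) f((u,v)γ)`
(§2.2 (8); the action for which the Levi–Delone–Faddeev bijection is `GL₂(ℤ)`-equivariant).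
Defined over any commutative ring and for every matrix (total). [cite: BhargavaTaniguchiThorne2023, §2.2 (8)] -/
def twist (γ : Matrix (Fin 2) (Fin 2) R) (f : BinaryCubic R) : BinaryCubic R :=
  γ.det • f.subst γ

/-- `(γ · f)(u,v) = det γ · f((u,v)γ)`. [folklore] -/
theorem eval_twist (γ : Matrix (Fin 2) (Fin 2) R) (f : BinaryCubic R) (u v : R) :
    (twist γ f).eval u v = γ.det * f.eval (u * γ 0 0 + v * γ 1 0) (u * γ 0 1 + v * γ 1 1) := by
  rw [twist, eval_smul, eval_subst]

/-- The identity acts trivially under the twisted action. [folklore] -/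
@[simp] theorem twist_one (f : BinaryCubic R) : twist 1 f = f := by
  simp [twist]

/-- The twisted action is a left action: `(γ₁γ₂) · f = γ₁ · (γ₂ · f)`. [folklore] -/
theorem twist_mul (γ₁ γ₂ : Matrix (Fin 2) (Fin 2) R) (f : BinaryCubic R) :
    twist (γ₁ * γ₂) f = twist γ₁ (twist γ₂ f) := by
  simp only [twist, Matrix.det_mul, subst_mul, smul_subst, ← mul_smul]

/-- `Disc(γ · f) = (det γ)¹⁰ Disc(f)` for the twisted action (`(det γ)⁴` from the scaling,
`(det γ)⁶` from the substitution). [folklore] -/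
theorem disc_twist (γ : Matrix (Fin 2) (Fin 2) R) (f : BinaryCubic R) :
    (twist γ f).disc = γ.det ^ 10 * f.disc := by
  rw [twist, disc_smul, disc_subst]
  ring

end CommRing

/-! ### `GL₂(ℤ)`-orbits of integral forms -/

/-- **`Disc(γ · f) = Disc(f)` for `γ ∈ GL₂(ℤ)`** (an integral matrix with unit determinant:
`det γ = ±1`, so `(det γ)¹⁰ = 1`) — the Levi–Delone–Faddeev bijection is
"discriminant-preserving" on the forms side (BTT 2023, §2.2). [cite: BhargavaTaniguchiThorne2023, §2.2 (8)] -/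
theorem disc_twist_of_isUnit {γ : Matrix (Fin 2) (Fin 2) ℤ} (hγ : IsUnit γ.det) (f : BinaryCubic ℤ) :
    (twist γ f).disc = f.disc := by
  rw [disc_twist]
  rcases Int.isUnit_iff.mp hγ with h | h <;> rw [h] <;> norm_num

/-- `GL₂(ℤ)`-equivalence of integral binary cubic forms for the twisted action:
`g = γ · f` for some integral `γ` with `det γ = ±1` (the `GL₂(ℤ)`-orbits on `V(ℤ)` of BTT 2023,
Thm 2.1). [cite: BhargavaTaniguchiThorne2023, §2.2 (GL₂(ℤ)-orbits on V(ℤ))] -/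
def GL2ZEquiv (f g : BinaryCubic ℤ) : Prop :=
  ∃ γ : Matrix (Fin 2) (Fin 2) ℤ, IsUnit γ.det ∧ g = twist γ f

/-- `GL₂(ℤ)`-equivalence is reflexive. [folklore] -/
theorem GL2ZEquiv.refl (f : BinaryCubic ℤ) : GL2ZEquiv f f :=
  ⟨1, by simp, by simp⟩

/-- `GL₂(ℤ)`-equivalence is transitive. [folklore] -/
theorem GL2ZEquiv.trans {f g h : BinaryCubic ℤ} (h₁ : GL2ZEquiv f g) (h₂ : GL2ZEquiv g h) :
    GL2ZEquiv f h := by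
  obtain ⟨γ₁, hγ₁, rfl⟩ := h₁
  obtain ⟨γ₂, hγ₂, rfl⟩ := h₂
  exact ⟨γ₂ * γ₁, by rw [Matrix.det_mul]; exact hγ₂.mul hγ₁, (twist_mul γ₂ γ₁ f).symm⟩

/-- `GL₂(ℤ)`-equivalence is symmetric (the inverse of an integral matrix with unit determinant is
integral with unit determinant). [folklore] -/
theorem GL2ZEquiv.symm {f g : BinaryCubic ℤ} (h : GL2ZEquiv f g) : GL2ZEquiv g f := by
  obtain ⟨γ, hγ, rfl⟩ := h
  refine ⟨γ⁻¹, Matrix.isUnit_nonsing_inv_det_iff.mpr hγ, ?_⟩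
  rw [← twist_mul, Matrix.nonsing_inv_mul γ hγ, twist_one]

/-- `GL₂(ℤ)`-equivalence is an equivalence relation. [folklore] -/
theorem GL2ZEquiv.equivalence : Equivalence GL2ZEquiv :=
  ⟨GL2ZEquiv.refl, GL2ZEquiv.symm, GL2ZEquiv.trans⟩

/-- Equivalent forms have the same discriminant (BTT 2023, Thm 2.1: the orbit ↦ ring bijection is
"discriminant-preserving"; this is the forms-side input). [folklore] -/
theorem GL2ZEquiv.disc_eq {f g : BinaryCubic ℤ} (h : GL2ZEquiv f g) : g.disc = f.disc := by
  obtain ⟨γ, hγ, rfl⟩ := h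
  exact disc_twist_of_isUnit hγ f

/-- The `GL₂(ℤ)`-orbit (equivalence class) of an integral binary cubic form. [folklore] -/
def gl2zOrbit (f : BinaryCubic ℤ) : Set (BinaryCubic ℤ) :=
  {g | GL2ZEquiv f g}

/-- `f` lies in its own orbit. [folklore] -/
theorem mem_gl2zOrbit_self (f : BinaryCubic ℤ) : f ∈ gl2zOrbit f :=
  GL2ZEquiv.refl f

/-- Two forms have the same orbit iff they are equivalent. [folklore] -/
theorem gl2zOrbit_eq_iff {f g : BinaryCubic ℤ} : gl2zOrbit f = gl2zOrbit g ↔ GL2ZEquiv f g := by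
  constructor
  · intro h
    have hg : g ∈ gl2zOrbit f := by rw [h]; exact mem_gl2zOrbit_self g
    exact hg
  · intro h
    ext k
    exact ⟨fun hk => (h.symm).trans hk, fun hk => h.trans hk⟩

/-- The content of an integral form (the gcd of its coefficients; BTT 2023, §2.2: "the content of
a binary cubic form is the gcd of its coefficients"). [cite: BhargavaTaniguchiThorne2023, §2.2 (content)] -/
def content (f : BinaryCubic ℤ) : ℕ :=
  Int.gcd (Int.gcd f.a f.b) (Int.gcd f.c f.d)

/-- The content divides every coefficient. [folklore] -/
theorem content_dvd (f : BinaryCubic ℤ) :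
    (f.content : ℤ) ∣ f.a ∧ (f.content : ℤ) ∣ f.b ∧ (f.content : ℤ) ∣ f.c ∧ (f.content : ℤ) ∣ f.d := by
  have hab : ((Int.gcd (Int.gcd f.a f.b) (Int.gcd f.c f.d) : ℕ) : ℤ) ∣ (Int.gcd f.a f.b : ℤ) :=
    Int.natCast_dvd_natCast.mpr (Nat.gcd_dvd_left _ _)
  have hcd : ((Int.gcd (Int.gcd f.a f.b) (Int.gcd f.c f.d) : ℕ) : ℤ) ∣ (Int.gcd f.c f.d : ℤ) :=
    Int.natCast_dvd_natCast.mpr (Nat.gcd_dvd_right _ _)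
  exact ⟨hab.trans (Int.gcd_dvd_left _ _), hab.trans (Int.gcd_dvd_right _ _),
    hcd.trans (Int.gcd_dvd_left _ _), hcd.trans (Int.gcd_dvd_right _ _)⟩

end BinaryCubic

end Literature.NumberTheory.CubicFields
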